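import Mathlib
import HarnessLib
import Literature.Probability.MarkovChains.QMatrix
import Literature.Probability.MarkovChains.KolmogorovEquations
import Literature.Probability.MarkovChains.ProjectedChain

/-!
# Ordinary lumpability of a continuous-time chain: the aggregated generator `q̂(S_i,S_j) = Σ_{s'∈S_j} q(s,s')`, the lumped semigroup, and the aggregated equilibrium `π̂(S) = Σ_{s∈S} π(s)` (Marin–Piazza–Rossi, Definition 1 / Proposition 1; Kemeny–Snell)

HONEST FRAMING: exact (Metropolis-corrected) sampling algorithms for lattice gauge theory; figures
of merit are autocorrelation/cost numbers at stated couplings and volumes; no continuum-physics claim.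

Sources.  A. Marin, C. Piazza, S. Rossi, "Proportional lumpability and proportional bisimilarity",
*Acta Informatica* 59 (2022) 211–244 [MarinPiazzaRossi2021], §2.2 "Lumpability": DEFINITION 1
(ordinary lumpability) "`∼` induces a partition on the state space of `X(t)` such that for any
equivalence classes `S_i, S_j ∈ S/∼` with `S_i ≠ S_j` and `s, s' ∈ S_i`, `Σ_{s''∈S_j} q(s,s'') =
Σ_{s''∈S_j} q(s',s'')`"; "In [22] [Kemeny–Snell], the authors prove that … the aggregated process is a
Markov chain for every initial distribution if, and only if, `∼` is a ordinary lumpability for `X(t)`.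
Moreover, the transition rate between two aggregated states `S_i, S_j` is equal to `Σ_{s'∈S_j} q(s,s')`
for any `s ∈ S_i`"; PROPOSITION 1 (aggregated process for ordinary lumpability): the aggregated
generator `q̃(S_i,S_j) = Σ_{s'∈S_j} q(s,s')` and "the equilibrium distribution `π̃` of `X̃(t)` is such
that for any equivalence class `S`, `π̃(S) = Σ_{s∈S} π(s)`".  J. G. Kemeny, J. L. Snell, *Finite Markov
Chains*, Springer 1976 [KemenySnell1976], §6.3 "Lumped chains" (Definition 6.3.1; Theorem 6.3.2: the
row-sum criterion; Theorems 6.3.4–6.3.5: the matrix form `VUPV = PV`, i.e. `PV = VP̂` with `P̂ = UPV`,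
`V` the block-indicator matrix).  Everything is PROVED (0 named facts, 0 sorry).

SETTING AND RENDERING.  Finite state space `I`; `Q : I → I → ℝ` (a Q-matrix where stated); a partition
is a map `blk : I → B` onto a finite type of blocks, with representatives `rep : B → I`,
`blk (rep b) = b`.  The tree has no trajectory space: "the aggregated process is a CTMC with generator
`Q̂`" is rendered as the LUMPED SEMIGROUP IDENTITY `Σ_{j∈S_{b'}} p_{ij}(t) = p̂_{blk i, b'}(t)` with
`p̂(t) = e^{tQ̂}` (`IsOrdinaryLumpable.sum_ctSemigroup_eq`) — the finite-dimensional distributions of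
the block process started at `i` are then those of the chain `Q̂` started at `blk i`, by the Markov
property — proved from the intertwining `QU = UQ̂` by uniqueness for the backward system `y' = Qy`.

* `aggregatedRate Q blk i b = Σ_{j∈S_b} q(i,j)`; **DEFINITION 1** `IsOrdinaryLumpable Q blk` (all
  blocks; `IsOrdinaryLumpable.of_ne`: the printed "`S_i ≠ S_j`" form suffices for a Q-matrix)
  [cite: MarinPiazzaRossi2021, §2.2 Definition 1] [cite: KemenySnell1976, §6.3 Def. 6.3.1, Thm 6.3.2];
* `lumpedGenerator Q blk rep` = `q̂`, `lumpedGenerator_eq_aggregatedRate` (any representative),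
  `lumpedGenerator_isQMatrix`, `IsOrdinaryLumpable.intertwine` (`QU = UQ̂`)
  [cite: MarinPiazzaRossi2021, §2.2 Prop. 1] [cite: KemenySnell1976, §6.3 Thms 6.3.4–6.3.5];
* **PROPOSITION 1** `MarinPiazzaRossi2021_prop_1` (`π̂(S) = Σ_{s∈S}π(s)` is invariant for `Q̂`
  whenever `πQ = 0`), `sum_lumpedLaw` [cite: MarinPiazzaRossi2021, §2.2 Prop. 1];
* `sum_Q_mul_ctSemigroup_comm` (`QP(s) = P(s)Q` entrywise), `backward_system_unique` (two solutions
  of `y' = Qy` with equal initial data agree) [cite: Norris1997, §2.1 Thm 2.1.1 and its proof];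
* **THE LUMPED SEMIGROUP** `IsOrdinaryLumpable.sum_ctSemigroup_eq` [cite: MarinPiazzaRossi2021, §2.2
  (paragraph before Prop. 1) and Prop. 1] [cite: KemenySnell1976, §6.3 Thms 6.3.2, 6.3.4–6.3.5];
* discrete time: `IsOrdinaryLumpable.sum_pow_eq` — `Σ_{j∈S_{b'}} (Pⁿ)_{ij} = (P̂ⁿ)_{blk i,b'}` for a
  lumpable transition matrix [cite: KemenySnell1976, §6.3 Thms 6.3.2, 6.3.4–6.3.5].

* bridge to the tree's discrete-time lumping: `IsOrdinaryLumpable.hlump` (under ordinary lumpability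
  `P̂ = lumpedGenerator P blk rep` satisfies the lumping hypothesis `P♯([x],c) = Σ_{z∈c} P(x,z)` of
  `ProjectedChain.lean`, Levin–Peres–Wilmer eq. (2.10)), whence `IsOrdinaryLumpable.sum_lawAt_eq`
  (Lemma 2.5: block laws of `μPᵗ` = block law of `μ` advanced by `P̂ᵗ`) and
  `IsOrdinaryLumpable.isStationary_lumped` [cite: LevinPeres2017, §2.3.1 Lemma 2.5]
  [cite: KemenySnell1976, §6.3 Thm 6.3.2].

RELATION TO THE TREE (nothing there is re-declared or re-proved): `ProjectedChain.lean` is the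
DISCRETE-TIME lumping of Levin–Peres–Wilmer Lemma 2.5 / Lemma 12.9, with the lumping condition carried
as a hypothesis (`hlump`) on an abstract projected kernel `P♯`; the present file names the condition
(`IsOrdinaryLumpable`, Kemeny–Snell's row-sum criterion = Marin–Piazza–Rossi's Definition 1), builds
the aggregated GENERATOR of a continuous-time chain and proves the lumped SEMIGROUP identity for
`e^{tQ}`, and plugs into `ProjectedChain.lean` for the discrete statements (the bridge above).

NOT CLAIMED: the converse ("only if") of Kemeny–Snell's theorem; quasi- and proportional lumpability
(§§2.2–2.3 of the paper).

Context (cell pub-lqcd, venture LatticeQCDFlow): projecting a sampler's dynamics onto a coarse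
variable (topological sector, action bin) is exact precisely under lumpability; then autocorrelations
of block observables are those of the small chain `Q̂`.
-/

namespace Literature.Probability.MarkovChains

open NormedSpace Finset Matrix

variable {I : Type*} [Fintype I] {B : Type*} [DecidableEq B]

/-- The aggregated rate from state `i` into the block `b`: `q_∼(i, b) = Σ_{j : blk j = b} q(i,j)`.
[cite: MarinPiazzaRossi2021, §2.2 Definition 1 (the sums `Σ_{s'∈S_j} q(s,s')`)] -/
def aggregatedRate (Q : I → I → ℝ) (blk : I → B) (i : I) (b : B) : ℝ :=
  ∑ j, if blk j = b then Q i j else 0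

/-- **DEFINITION 1 (ordinary lumpability).**  The partition `blk : I → B` of the state space is an
ordinary lumpability for the generator `Q` if any two states of the same block have the same
aggregated rate into every block: `blk i = blk i' ⇒ Σ_{j∈S_b} q(i,j) = Σ_{j∈S_b} q(i',j)` for all `b`
(the source asks it for `S_b ≠` the own block; with zero row sums the own block then follows, see
`IsOrdinaryLumpable.of_ne`). [cite: MarinPiazzaRossi2021, §2.2 Definition 1]
[cite: KemenySnell1976, §6.3 Definition 6.3.1 and Theorem 6.3.2 (lumpability, discrete time)] -/
def IsOrdinaryLumpable (Q : I → I → ℝ) (blk : I → B) : Prop :=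
  ∀ i i', blk i = blk i' → ∀ b, aggregatedRate Q blk i b = aggregatedRate Q blk i' b

/-- Total rate out of all blocks is the row sum: `Σ_b q_∼(i,b) = Σ_j q(i,j)`.
[cite: MarinPiazzaRossi2021, §2.1 (generator rows sum to zero)] -/
theorem sum_aggregatedRate [Fintype B] (Q : I → I → ℝ) (blk : I → B) (i : I) :
    ∑ b, aggregatedRate Q blk i b = ∑ j, Q i j := by
  unfold aggregatedRate
  rw [sum_comm]
  exact sum_congr rfl fun j _ => by rw [sum_ite_eq univ (blk j), if_pos (mem_univ _)]

/-- The source's form of Definition 1 (only blocks OTHER than the own one) implies the tree's form,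
for a Q-matrix: the own-block aggregated rate is minus the sum of the others.
[cite: MarinPiazzaRossi2021, §2.2 Definition 1 ("for any equivalence classes `S_i, S_j ∈ S/∼` with
`S_i ≠ S_j` and `s, s' ∈ S_i`")] -/
theorem IsOrdinaryLumpable.of_ne [Fintype B] {Q : I → I → ℝ} (hQ : IsQMatrix Q) {blk : I → B}
    (h : ∀ i i', blk i = blk i' → ∀ b, b ≠ blk i → aggregatedRate Q blk i b = aggregatedRate Q blk i' b) :
    IsOrdinaryLumpable Q blk := by
  intro i i' hii' b
  by_cases hb : b = blk i
  · -- own block: use the zero row sums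
    have hi : ∑ c, aggregatedRate Q blk i c = 0 := by rw [sum_aggregatedRate, hQ.2 i]
    have hi' : ∑ c, aggregatedRate Q blk i' c = 0 := by rw [sum_aggregatedRate, hQ.2 i']
    rw [← Finset.add_sum_erase univ _ (mem_univ b)] at hi hi'
    have hrest : ∑ c ∈ univ.erase b, aggregatedRate Q blk i c = ∑ c ∈ univ.erase b, aggregatedRate Q blk i' c :=
      sum_congr rfl fun c hc => h i i' hii' c (fun hcb => (mem_erase.1 hc).1 (hcb.trans hb.symm))
    linarith
  · exact h i i' hii' b hb

/-- The AGGREGATED GENERATOR on the blocks, read off at block representatives `rep` (`blk ∘ rep = id`):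
`q̂(S_b, S_{b'}) = Σ_{s'∈S_{b'}} q(rep b, s')`; under ordinary lumpability the choice of representative
is immaterial (`lumpedGenerator_eq_aggregatedRate`). [cite: MarinPiazzaRossi2021, §2.2 Proposition 1
("infinitesimal generator `Q̃` defined by `q̃(S_i,S_j) = Σ_{s'∈S_j} q(s,s')` for any `s ∈ S_i`")] -/
def lumpedGenerator (Q : I → I → ℝ) (blk : I → B) (rep : B → I) : B → B → ℝ :=
  fun b b' => aggregatedRate Q blk (rep b) b'

/-- `q̂(blk i, b') = Σ_{j∈S_{b'}} q(i,j)` for EVERY `i` (not only the representative).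
[cite: MarinPiazzaRossi2021, §2.2 Proposition 1 ("for any `s ∈ S_i`")] -/
theorem lumpedGenerator_eq_aggregatedRate {Q : I → I → ℝ} {blk : I → B} (h : IsOrdinaryLumpable Q blk)
    {rep : B → I} (hrep : ∀ b, blk (rep b) = b) (i : I) (b' : B) :
    lumpedGenerator Q blk rep (blk i) b' = aggregatedRate Q blk i b' :=
  h (rep (blk i)) i (hrep (blk i)) b'

/-- The aggregated generator is a Q-matrix. [cite: MarinPiazzaRossi2021, §2.2 Proposition 1 (the
aggregated process is a CTMC with generator `Q̃`)] -/
theorem lumpedGenerator_isQMatrix [Fintype B] {Q : I → I → ℝ} (hQ : IsQMatrix Q) (blk : I → B)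
    {rep : B → I} (hrep : ∀ b, blk (rep b) = b) : IsQMatrix (lumpedGenerator Q blk rep) := by
  refine ⟨fun b b' hbb' => sum_nonneg fun j _ => ?_, fun b => ?_⟩
  · split_ifs with hj
    · exact hQ.1 (rep b) j (fun h => hbb' (by rw [← hrep b, h, hj]))
    · exact le_rfl
  · show ∑ b', aggregatedRate Q blk (rep b) b' = 0
    rw [sum_aggregatedRate, hQ.2]

/-- THE INTERTWINING RELATION `QU = UQ̂` with `U(i,b) = 1{blk i = b}`: for every `i` and block `b'`,
`Σ_j q(i,j) 1{blk j = b'} = q̂(blk i, b')`. [cite: KemenySnell1976, §6.3 (`VUPV = PV`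
with `V` the block-indicator matrix: Theorems 6.3.4–6.3.5)] [cite: MarinPiazzaRossi2021, §2.2
Definition 1 / Proposition 1] -/
theorem IsOrdinaryLumpable.intertwine {Q : I → I → ℝ} {blk : I → B} (h : IsOrdinaryLumpable Q blk)
    {rep : B → I} (hrep : ∀ b, blk (rep b) = b) (i : I) (b' : B) :
    ∑ j, Q i j * (if blk j = b' then 1 else 0) = lumpedGenerator Q blk rep (blk i) b' := by
  rw [lumpedGenerator_eq_aggregatedRate h hrep]
  unfold aggregatedRate
  exact sum_congr rfl fun j _ => by split_ifs <;> simp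

/-- **PROPOSITION 1 (aggregated equilibrium).**  If `π` is invariant for `Q` (`πQ = 0`) then
`π̂(S) = Σ_{s∈S} π(s)` is invariant for the aggregated generator. [cite: MarinPiazzaRossi2021, §2.2
Proposition 1 ("the equilibrium distribution `π̃` of `X̃(t)` is such that … `π̃(S) = Σ_{s∈S} π(s)`")] -/
theorem MarinPiazzaRossi2021_prop_1 [Fintype B] {Q : I → I → ℝ} {blk : I → B}
    (h : IsOrdinaryLumpable Q blk)
    {rep : B → I} (hrep : ∀ b, blk (rep b) = b) {π : I → ℝ} (hπ : IsInvariantQ π Q) :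
    IsInvariantQ (fun b => ∑ i, if blk i = b then π i else 0) (lumpedGenerator Q blk rep) := by
  intro b'
  -- `Σ_b π̂(b) q̂(b,b') = Σ_i π(i) q̂(blk i, b') = Σ_i π(i) Σ_{j∈b'} q(i,j) = Σ_{j∈b'} (πQ)_j = 0`
  calc ∑ b, (∑ i, if blk i = b then π i else 0) * lumpedGenerator Q blk rep b b'
      = ∑ i, π i * lumpedGenerator Q blk rep (blk i) b' := by
        simp_rw [sum_mul]
        rw [sum_comm]
        refine sum_congr rfl fun i _ => ?_
        rw [show (∑ b, (if blk i = b then π i else 0) * lumpedGenerator Q blk rep b b') =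
            ∑ b, if blk i = b then π i * lumpedGenerator Q blk rep b b' else 0 from
          sum_congr rfl fun b _ => by split_ifs <;> simp, sum_ite_eq univ (blk i), if_pos (mem_univ _)]
    _ = ∑ i, π i * aggregatedRate Q blk i b' :=
        sum_congr rfl fun i _ => by rw [lumpedGenerator_eq_aggregatedRate h hrep]
    _ = ∑ j, if blk j = b' then ∑ i, π i * Q i j else 0 := by
        unfold aggregatedRate
        simp_rw [mul_sum]
        rw [sum_comm]
        refine sum_congr rfl fun j _ => ?_
        split_ifs <;> simp
    _ = 0 := sum_eq_zero fun j _ => by split_ifs <;> simp [hπ j]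

/-- The aggregated vector sums to the same total (`Σ_S π̂(S) = Σ_s π(s)`), so an invariant
DISTRIBUTION lumps to an invariant distribution. [cite: MarinPiazzaRossi2021, §2.2 Proposition 1] -/
theorem sum_lumpedLaw [Fintype B] (blk : I → B) (π : I → ℝ) :
    ∑ b, (∑ i, if blk i = b then π i else 0) = ∑ i, π i := by
  rw [sum_comm]
  exact sum_congr rfl fun i _ => by rw [sum_ite_eq univ (blk i), if_pos (mem_univ _)]

/-! ## The lumped semigroup: `Σ_{s'∈S_j} p_{s s'}(t) = p̂_{S_i S_j}(t)` -/

section Semigroup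

variable [DecidableEq I]

/-- `Q` commutes with its semigroup entrywise: `Σ_k q_{ik} p_{kj}(s) = Σ_k p_{ik}(s) q_{kj}` (backward and
forward equations give the same derivative). [cite: Norris1997, §2.1 Thm 2.1.1 (ii)–(iii)] -/
theorem sum_Q_mul_ctSemigroup_comm (Q : I → I → ℝ) (s : ℝ) (i j : I) :
    ∑ k, Q i k * ctSemigroup Q s k j = ∑ k, ctSemigroup Q s i k * Q k j :=
  (hasDerivAt_ctSemigroup_backward Q s i j).unique (hasDerivAt_ctSemigroup_forward Q s i j)

/-- UNIQUENESS FOR THE BACKWARD SYSTEM `y' = Qy`: two vector solutions with the same initial value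
coincide — `t ↦ Σ_k p_{ik}(−t) (y_k(t) − z_k(t))` has zero derivative. [cite: Stroock2014, §5.2.3
(after eq. (5.2.15): "suppose … `Ṁ(t) = QM(t)`. Then `M(t) = 0` for `t ≥ 0` if `M(0) = 0` … Applying
this to the difference of two solutions … the difference vanishes")] [cite: Norris1997, §2.1, proof
of Thm 2.1.1 (the `M(t)e^{−tQ}` argument)]  (The tree's `KolmogorovEquations.lean` has the MATRIX
form with `M(0) = I`, `Norris1997_thm_2_1_1_backward_unique`; this is the column-vector form with
arbitrary initial data, which the lumped-semigroup proof below needs.) -/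
theorem backward_system_unique (Q : I → I → ℝ) {y z : ℝ → I → ℝ}
    (hy : ∀ t i, HasDerivAt (fun u => y u i) (∑ k, Q i k * y t k) t)
    (hz : ∀ t i, HasDerivAt (fun u => z u i) (∑ k, Q i k * z t k) t) (h0 : y 0 = z 0) (t : ℝ) :
    y t = z t := by
  -- the difference `w`
  set w : ℝ → I → ℝ := fun u i => y u i - z u i with hw
  have hwd : ∀ t i, HasDerivAt (fun u => w u i) (∑ k, Q i k * w t k) t := by
    intro t i
    have h := (hy t i).sub (hz t i)
    refine h.congr_deriv ?_
    simp only [hw, mul_sub, sum_sub_distrib]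
  have hw0 : ∀ i, w 0 i = 0 := fun i => by simp [hw, h0]
  -- `G_i(u) = Σ_k p_{ik}(−u) w_k(u)` is constant
  have hE : ∀ u i k, HasDerivAt (fun v : ℝ => ctSemigroup Q (-v) i k)
      (-(∑ m, Q i m * ctSemigroup Q (-u) m k)) u := by
    intro u i k
    have h := HasDerivAt.comp u (hasDerivAt_ctSemigroup_backward Q (-u) i k) (hasDerivAt_neg u)
    simpa [Function.comp_def, mul_neg, mul_one] using h
  have hG : ∀ i u, HasDerivAt (fun v : ℝ => ∑ k, ctSemigroup Q (-v) i k * w v k) 0 u := by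
    intro i u
    have h := HasDerivAt.sum (u := univ)
      (A := fun (k : I) (v : ℝ) => ctSemigroup Q (-v) i k * w v k)
      (A' := fun k => -(∑ m, Q i m * ctSemigroup Q (-u) m k) * w u k +
        ctSemigroup Q (-u) i k * ∑ m, Q k m * w u m)
      (x := u) fun k _ => (hE u i k).mul (hwd u k)
    refine (h.congr_of_eventuallyEq (Filter.Eventually.of_forall fun v => ?_)).congr_deriv ?_
    · simp only [Finset.sum_apply]
    · -- `−Σ_k Σ_m q_{im} p_{mk} w_k + Σ_k Σ_m p_{ik} q_{km} w_m = 0` by the commutation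
      have h1 : ∑ k, (∑ m, Q i m * ctSemigroup Q (-u) m k) * w u k =
          ∑ k, ctSemigroup Q (-u) i k * ∑ m, Q k m * w u m := by
        calc ∑ k, (∑ m, Q i m * ctSemigroup Q (-u) m k) * w u k
            = ∑ k, (∑ m, ctSemigroup Q (-u) i m * Q m k) * w u k := by
              refine sum_congr rfl fun k _ => ?_; rw [sum_Q_mul_ctSemigroup_comm]
          _ = ∑ k, ∑ m, ctSemigroup Q (-u) i m * (Q m k * w u k) := by
              refine sum_congr rfl fun k _ => ?_
              rw [sum_mul]
              exact sum_congr rfl fun m _ => by ring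
          _ = ∑ m, ∑ k, ctSemigroup Q (-u) i m * (Q m k * w u k) := sum_comm
          _ = ∑ m, ctSemigroup Q (-u) i m * ∑ k, Q m k * w u k := by
              refine sum_congr rfl fun m _ => ?_; rw [mul_sum]
      simp only [neg_mul]
      rw [sum_add_distrib, sum_neg_distrib, h1, neg_add_cancel]
  have hGconst : ∀ i, (∑ k, ctSemigroup Q (-t) i k * w t k) = 0 := by
    intro i
    have hc := is_const_of_deriv_eq_zero (f := fun v : ℝ => ∑ k, ctSemigroup Q (-v) i k * w v k)
      (fun v => (hG i v).differentiableAt) (fun v => (hG i v).deriv) t 0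
    rw [hc]
    simp [ctSemigroup_zero, hw0]
  -- undo `p(−t)` with `p(t)`: `w_j(t) = Σ_i p_{ji}(t) G_i(t) = 0`
  funext j
  have hsum : w t j = ∑ i, ctSemigroup Q t j i * ∑ k, ctSemigroup Q (-t) i k * w t k := by
    simp_rw [mul_sum, ← mul_assoc]
    rw [sum_comm]
    simp_rw [← sum_mul]
    have hst : ∀ k, ∑ i, ctSemigroup Q t j i * ctSemigroup Q (-t) i k = if j = k then 1 else 0 := by
      intro k
      rw [← Norris1997_thm_2_1_1_i Q t (-t) j k, add_neg_cancel, ctSemigroup_zero]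
    simp_rw [hst, ite_mul, one_mul, zero_mul, sum_ite_eq, mem_univ, if_true]
  have : w t j = 0 := by
    rw [hsum]
    exact sum_eq_zero fun i _ => by rw [hGconst i, mul_zero]
  simpa [hw, sub_eq_zero] using this

end Semigroup

section Lumped

variable [DecidableEq I] [Fintype B]

/-- **THE LUMPED SEMIGROUP (Kemeny–Snell's theorem, continuous time).**  Under ordinary lumpability,
for every state `i`, block `S_{b'}` and `t`: `Σ_{j∈S_{b'}} p_{ij}(t) = p̂_{blk i, b'}(t)`, where
`p̂(t) = e^{tQ̂}` is the semigroup of the aggregated generator — the transition function of the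
process aggregated over blocks depends on the starting state only through its block and is that of
the CTMC with generator `Q̂` ("the aggregated process is a Markov chain for every initial
distribution iff `∼` is an ordinary lumpability", analytic content).  Proof: both sides solve the
backward system `y' = Qy` in `i` with the same initial value `1{blk i = b'}` (the right side by the
intertwining `QU = UQ̂`), so they agree (`backward_system_unique`). [cite: MarinPiazzaRossi2021, §2.2
(the paragraph before Proposition 1, citing [22]) and Proposition 1] [cite: KemenySnell1976, §6.3
Theorems 6.3.2, 6.3.4–6.3.5] -/
theorem IsOrdinaryLumpable.sum_ctSemigroup_eq {Q : I → I → ℝ} {blk : I → B}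
    (h : IsOrdinaryLumpable Q blk) {rep : B → I} (hrep : ∀ b, blk (rep b) = b) (t : ℝ) (i : I)
    (b' : B) :
    (∑ j, if blk j = b' then ctSemigroup Q t i j else 0) =
      ctSemigroup (lumpedGenerator Q blk rep) t (blk i) b' := by
  set Qh := lumpedGenerator Q blk rep with hQh
  -- left side as a solution of the backward system
  have hy : ∀ (u : ℝ) (i : I), HasDerivAt
      (fun v : ℝ => ∑ j, if blk j = b' then ctSemigroup Q v i j else 0)
      (∑ k, Q i k * ∑ j, if blk j = b' then ctSemigroup Q u k j else 0) u := by
    intro u i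
    have hs := HasDerivAt.sum (u := univ)
      (A := fun (j : I) (v : ℝ) => if blk j = b' then ctSemigroup Q v i j else 0)
      (A' := fun j => if blk j = b' then ∑ k, Q i k * ctSemigroup Q u k j else 0) (x := u)
      fun j _ => by
        by_cases hj : blk j = b'
        · simp only [hj, if_true]; exact hasDerivAt_ctSemigroup_backward Q u i j
        · simp only [hj, if_false]; exact hasDerivAt_const u 0
    refine (hs.congr_of_eventuallyEq (Filter.Eventually.of_forall fun v => ?_)).congr_deriv ?_
    · simp only [Finset.sum_apply]
    · simp_rw [mul_sum]
      rw [sum_comm]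
      exact sum_congr rfl fun j _ => by split_ifs <;> simp
  -- right side as a solution of the backward system (intertwining)
  have hz : ∀ (u : ℝ) (i : I), HasDerivAt (fun v : ℝ => ctSemigroup Qh v (blk i) b')
      (∑ k, Q i k * ctSemigroup Qh u (blk k) b') u := by
    intro u i
    refine (hasDerivAt_ctSemigroup_backward Qh u (blk i) b').congr_deriv ?_
    -- `Σ_c q̂(blk i, c) p̂_c(u) = Σ_k q(i,k) p̂_{blk k}(u)`
    calc ∑ c, Qh (blk i) c * ctSemigroup Qh u c b'
        = ∑ c, (∑ k, Q i k * (if blk k = c then 1 else 0)) * ctSemigroup Qh u c b' := by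
          refine sum_congr rfl fun c _ => ?_; rw [h.intertwine hrep i c]
      _ = ∑ k, Q i k * ∑ c, (if blk k = c then 1 else 0) * ctSemigroup Qh u c b' := by
          simp_rw [sum_mul, mul_sum, mul_assoc]; rw [sum_comm]
      _ = ∑ k, Q i k * ctSemigroup Qh u (blk k) b' := by
          refine sum_congr rfl fun k _ => ?_
          simp_rw [ite_mul, one_mul, zero_mul]
          rw [sum_ite_eq univ (blk k), if_pos (mem_univ _)]
  -- same initial values
  have h0 : (fun i : I => ∑ j, if blk j = b' then ctSemigroup Q 0 i j else 0) =
      fun i => ctSemigroup Qh 0 (blk i) b' := by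
    funext i
    simp only [ctSemigroup_zero]
    by_cases hib : blk i = b'
    · rw [if_pos hib]
      rw [Finset.sum_eq_single i (fun j _ hj => by
          by_cases hjb : blk j = b' <;> simp [hjb, Ne.symm hj]) (fun hi => absurd (mem_univ i) hi)]
      simp [hib]
    · rw [if_neg hib]
      exact sum_eq_zero fun j _ => by
        by_cases hjb : blk j = b'
        · rw [if_pos hjb, if_neg (fun hij : i = j => hib (by rw [hij]; exact hjb))]
        · rw [if_neg hjb]
  have := backward_system_unique Q
    (y := fun u i => ∑ j, if blk j = b' then ctSemigroup Q u i j else 0)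
    (z := fun u i => ctSemigroup Qh u (blk i) b') hy hz h0 t
  exact congrFun this i

end Lumped

/-! ## Discrete time (Kemeny–Snell, Theorem 6.3.2): powers of a lumpable kernel lump -/

section Discrete

variable [DecidableEq I] [Fintype B]

/-- **KEMENY–SNELL, discrete time.**  If a transition matrix `P` satisfies the lumpability condition
(the same row-sum condition, Theorem 6.3.2) then so do its powers, and the lumped `n`-step kernel is
the `n`-th power of the lumped kernel: `Σ_{j∈S_{b'}} (Pⁿ)_{ij} = (P̂ⁿ)_{blk i, b'}` — "the lumped process
is a Markov chain with transition matrix `P̂ = UPV`". [cite: KemenySnell1976, §6.3 Theorems 6.3.2,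
6.3.4–6.3.5] -/
theorem IsOrdinaryLumpable.sum_pow_eq {P : I → I → ℝ} {blk : I → B} (h : IsOrdinaryLumpable P blk)
    {rep : B → I} (hrep : ∀ b, blk (rep b) = b) :
    ∀ (n : ℕ) (i : I) (b' : B), (∑ j, if blk j = b' then (Matrix.of P ^ n) i j else 0) =
      (Matrix.of (lumpedGenerator P blk rep) ^ n) (blk i) b'
  | 0, i, b' => by
    simp only [pow_zero, Matrix.one_apply]
    by_cases hib : blk i = b'
    · rw [if_pos hib, Finset.sum_eq_single i (fun j _ hj => by
        by_cases hjb : blk j = b' <;> simp [hjb, Ne.symm hj]) (fun hi => absurd (mem_univ i) hi)]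
      simp [hib]
    · rw [if_neg hib]
      exact sum_eq_zero fun j _ => by
        by_cases hjb : blk j = b'
        · rw [if_pos hjb, if_neg (fun hij : i = j => hib (by rw [hij]; exact hjb))]
        · rw [if_neg hjb]
  | n + 1, i, b' => by
    -- `Pⁿ⁺¹ = P · Pⁿ`; lump the inner index with the induction hypothesis, then the outer with `h`
    rw [pow_succ', pow_succ']
    simp only [Matrix.mul_apply, Matrix.of_apply]
    calc (∑ j, if blk j = b' then ∑ k, P i k * (Matrix.of P ^ n) k j else 0)
        = ∑ k, P i k * ∑ j, if blk j = b' then (Matrix.of P ^ n) k j else 0 := by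
          simp_rw [mul_sum]
          rw [sum_comm]
          exact sum_congr rfl fun j _ => by by_cases hjb : blk j = b' <;> simp [hjb]
      _ = ∑ k, P i k * (Matrix.of (lumpedGenerator P blk rep) ^ n) (blk k) b' :=
          sum_congr rfl fun k _ => by rw [IsOrdinaryLumpable.sum_pow_eq h hrep n k b']
      _ = ∑ c, (∑ k, P i k * if blk k = c then 1 else 0) *
            (Matrix.of (lumpedGenerator P blk rep) ^ n) c b' := by
          simp_rw [sum_mul]
          rw [sum_comm]
          refine sum_congr rfl fun k _ => ?_
          simp_rw [mul_assoc, ← mul_sum]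
          congr 1
          simp_rw [ite_mul, one_mul, zero_mul]
          rw [sum_ite_eq univ (blk k), if_pos (mem_univ _)]
      _ = ∑ c, lumpedGenerator P blk rep (blk i) c *
            (Matrix.of (lumpedGenerator P blk rep) ^ n) c b' :=
          sum_congr rfl fun c _ => by rw [h.intertwine hrep i c]

/-! ### Bridge to the tree's discrete-time lumping (`ProjectedChain.lean`, Levin–Peres–Wilmer Lemma 2.5) -/

omit [DecidableEq I] [Fintype B] in
/-- Under ordinary lumpability, the lumped matrix read at representatives satisfies the lumping
hypothesis of `ProjectedChain.lean` (Levin–Peres–Wilmer eq. (2.10) / Lemma 2.5, there the hypothesis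
`hlump : P♯([x], c) = Σ_{z ∈ c} P(x, z)`), so every result of that file applies to
`lumpedGenerator P blk rep`. [cite: KemenySnell1976, §6.3 Theorem 6.3.2]
[cite: LevinPeres2017, §2.3.1 Lemma 2.5 eq. (2.10)] -/
theorem IsOrdinaryLumpable.hlump {P : I → I → ℝ} {blk : I → B} (h : IsOrdinaryLumpable P blk)
    {rep : B → I} (hrep : ∀ b, blk (rep b) = b) (x : I) (c : B) :
    lumpedGenerator P blk rep (blk x) c = ∑ z ∈ univ.filter (fun z => blk z = c), P x z := by
  rw [lumpedGenerator_eq_aggregatedRate h hrep, aggregatedRate, Finset.sum_filter]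

omit [DecidableEq I] in
/-- Hence, by Levin–Peres–Wilmer Lemma 2.5 as proved in `ProjectedChain.lean`: the block law of `μPᵗ`
is the block law of `μ` advanced by `P̂ᵗ`, `P̂ = lumpedGenerator P blk rep`.
[cite: LevinPeres2017, §2.3.1 Lemma 2.5] [cite: KemenySnell1976, §6.3 Theorems 6.3.2, 6.3.4–6.3.5] -/
theorem IsOrdinaryLumpable.sum_lawAt_eq {P : I → I → ℝ} {blk : I → B}
    (h : IsOrdinaryLumpable P blk) {rep : B → I} (hrep : ∀ b, blk (rep b) = b)
    (μ : I → ℝ) (t : ℕ) (c : B) :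
    ∑ x ∈ univ.filter (fun x => blk x = c), lawAt P μ t x
      = lawAt (lumpedGenerator P blk rep) (fun c' => ∑ x ∈ univ.filter (fun x => blk x = c'), μ x) t c :=
  LevinPeres2017_lemma_2_5_lawAt (h.hlump hrep) μ t c

omit [DecidableEq I] in
/-- … and the block sums of a stationary law of `P` form a stationary law of `P̂` — the discrete-time
counterpart of Proposition 1. [cite: LevinPeres2017, §2.3.1 Lemma 2.5]
[cite: MarinPiazzaRossi2021, §2.2 Proposition 1] -/
theorem IsOrdinaryLumpable.isStationary_lumped {P : I → I → ℝ} {blk : I → B}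
    (h : IsOrdinaryLumpable P blk) {rep : B → I} (hrep : ∀ b, blk (rep b) = b) {π : I → ℝ}
    (hst : IsStationary π P) :
    IsStationary (fun c => ∑ x ∈ univ.filter (fun x => blk x = c), π x) (lumpedGenerator P blk rep) :=
  lumpedKernel_isStationary hst (h.hlump hrep)

end Discrete

end Literature.Probability.MarkovChains
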